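import Summits.QuantumFields.YangMills.Theorems.SwapVirialDeficitBlowUpGnomonicFollowerBox
import Summits.QuantumFields.YangMills.Theorems.SwapVirialDeficitQuantitativeLaplaceCoerciveOfGrowthGauge
import Summits.QuantumFields.YangMills.Theorems.SwapVirialDeficitQuantitativeLaplaceTaylorDatumOfRays
import Summits.QuantumFields.YangMills.Theorems.SwapVirialDeficitGnomonicVirialIdentity
import Summits.QuantumFields.YangMills.Theorems.WeakCouplingRatesColdBoxChart
import HarnessLib

/-!
# (M2)(a) IN GNOMONIC COORDINATES: UNIFORM COERCIVITY OF THE FOLLOWER BLOCK AT `U ≡ 1` OVER THE NEAR-FLAT BASE, as a RAY SECOND DERIVATIVE,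
# modulo the quartic RAY REMAINDER — `μ·Σ_f|y_f|² ≤ d²/dt² F̂_z(C, gno⁺(t·y))|₀`, `μ = 1/(2304·L⁶·|Fol L|)`, every sector, hub-angle free
# (free-hands support of ⟨stmt-QuantumFields-24197⟩ `SwapVirialDeficit.SwapGluedStiffness`; brick W3, follower block, of LEAD ym-line-sfw-p2 g97's steep-window Morse–Bott plan)

Composition of landed pieces in the follower coordinates `y : Fol L → ℝ³` of the all-plus gnomonic chart `gno⁺(y)_f = quatToSU2 (gnoLetter true y_f)`:
growth ✓`gnoFollower_growth[_twisted]` (`μ·Σ|y_f|² ≤ F̂_z(C, gno⁺ y)` on the unit sup-box), the thin-toron energy ✓`chartDeficit[_twisted]_one_le_of_relations`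
(`F̂_z(C,1) ≤ 300L⁴s²`), the norm-free coercivity lemma ✓`gauge_coercive_of_growth_offset_half` with gauge `N(y) = Σ_f|y_f|²` and quadratic functional
`Q(y) = (d²/dt²) F̂_z(C, gno⁺(t·y))|₀` (homogeneous by ✓`raySecond_homogeneous`, the rays being `C^∞` by ✓`contDiff_chartDeficit_followers_param`), and PARITY for the
even remainder (✓`deriv_ray_neg` ∕ `iteratedDeriv_two/three_ray_neg`):
* `contDiff_gnoFollower_ray`, `gnoPlus_zero` (`gno⁺(0) = 1`), `sum_normSq3_smul`, `eq_zero_of_sum_normSq3_eq_zero`;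
* ★★★ `gnoFollower_raySecond_coercive_twisted` — for every sector `z`, every leader tuple `C` with commutators and SIGNED σ-relations `≤ s`, every radius `0 < R ≤ 1`
  and quartic ray-remainder constant `B₄` on `{Σ|y_f|² ≤ R²}` (HYPOTHESIS `h4`, the shape of fcl-p3 g47's ✓`taylor_four_chartDeficit_gnomonic` ∕ ⧗`…TaylorLine`), under
  the two polynomial smallness conditions `2·(300L⁴s²) ≤ μR²/2`, `2B₄R² ≤ μ/2`:  `μ·Σ_f|y_f|² ≤ (d²/dt²) F̂_z(C, gno⁺(t·y))|₀` for EVERY `y` — i.e. the fibre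
  Hessian of the follower block at the reference point is `μ`-coercive in the Euclidean follower norm, `μ = 1/(2304·L⁶·|Fol L|)`, uniformly in the hub angle and
  the base point (the `hcoer`∕floor input of ✓`laplaceMethod_quantitative_fibred_of_taylor` ∕ ✓`fibrePackage_of_hessian_floor` for the follower block);
  ★★★ `gnoFollower_raySecond_coercive` — principal sector, `χ ≡ 1`.
What is NOT here: the discharge of `h4` (jets), the leader-transverse block (hub stiffness), the operator packaging (✓`exists_isSymmetric_inner_eq_hess` does it on a Hilbert space).

HONEST LABEL: composition of landed inequalities modulo the stated ray-remainder hypothesis; ⟨24197⟩ (window-uniform) ∕ ⟨24196⟩ ∕ ⟨24194⟩ ∕ ⟨24497⟩ OPEN; own crux ⟨22884⟩ OPEN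
(blocked-on ⟨19935⟩); no crux, rung of record or summit is proved; the Yang–Mills mass gap is NOT proved; no summit is proved by a line.  THEOREMS ONLY (0 `def`, 0 `sorry`),
standard axioms.  Width seat ym-line-sfw-p2-w3 g65 (cell ym-idea-1, free hands), `--supports stmt-QuantumFields-24197`.  References: [cite: Luscher1983, §2]; [folklore].
-/

set_option autoImplicit false

noncomputable section

open MeasureTheory Quaternion
open scoped BigOperators Quaternion ContDiff
open Literature.MathematicalPhysics.QuantumFieldTheory hiding SU2
open Literature.MathematicalPhysics.QuantumLattice

namespace Summit.QuantumFields.YangMills.Theorems.SwapVirialDeficit.BlowUpRing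

open Summit.QuantumFields.YangMills.Theorems.FemtoTransferGap
open Summit.QuantumFields.YangMills.Theorems.FemtoTransferGap.TT
open Summit.QuantumFields.YangMills.Theorems.VirialFluxGap.RingDeficit
open Summit.QuantumFields.YangMills.Theorems.SwapVirialDeficit.SwapRing
open Summit.QuantumFields.YangMills.Theorems.SwapVirialDeficit.Gnomonic (normSq3 normSq3_nonneg normSq3_smul)
open Summit.QuantumFields.YangMills.Theorems.QuantitativeLaplace (gauge_coercive_of_growth_offset_half raySecond_homogeneous deriv_ray_neg iteratedDeriv_two_ray_neg
  iteratedDeriv_three_ray_neg)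
open Summit.QuantumFields.YangMills.Theorems.WeakCouplingRates (quatToSU2_one)
open Summit.QuantumFields.YangMills.Theorems.SwapVirialDeficit.Gnomonic (contDiff_chartDeficit_followers_param)

variable {L : ℕ} [NeZero L]

/-! ## §1 Letters -/

/-- The follower rays of the σ-glued deficit through the all-plus gnomonic chart are `C^∞`. [folklore] -/
theorem contDiff_gnoFollower_ray {n : ℕ∞} (z : Fin 3 → Bool) (χ : Site 3 L → SU2) (C : Fin 4 → SU2) (y : Fol L → Fin 3 → ℝ) :
    ContDiff ℝ n (fun t : ℝ => chartDeficit L z χ (C, fun f => quatToSU2 (gnoLetter true ((t • y) f)))) :=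
  contDiff_chartDeficit_followers_param (n := n) z χ C (fun _ => true) (φ := fun t : ℝ => t • y) (contDiff_id.smul contDiff_const)

omit [NeZero L] in
/-- `gno⁺(0) = 1`. [folklore] -/
theorem gnoPlus_zero : quatToSU2 (gnoLetter true (0 : Fin 3 → ℝ)) = 1 := by
  have e : gnoLetter true (0 : Fin 3 → ℝ) = 1 := by
    rw [gnoLetter_true]; ext <;> simp [gnomonicQuat]
  rw [e]; exact quatToSU2_one

/-- The follower gauge is homogeneous of degree two. [folklore] -/
theorem sum_normSq3_smul (t : ℝ) (y : Fol L → Fin 3 → ℝ) : ∑ f, normSq3 ((t • y) f) = t ^ 2 * ∑ f, normSq3 (y f) := by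
  rw [Finset.mul_sum]
  exact Finset.sum_congr rfl fun f _ => by rw [Pi.smul_apply, normSq3_smul]

/-- The follower gauge is definite. [folklore] -/
theorem eq_zero_of_sum_normSq3_eq_zero (y : Fol L → Fin 3 → ℝ) (h : ∑ f, normSq3 (y f) = 0) : y = 0 := by
  have hf : ∀ f, normSq3 (y f) = 0 := fun f =>
    (Finset.sum_eq_zero_iff_of_nonneg fun f _ => normSq3_nonneg (y f)).1 h f (Finset.mem_univ f)
  funext f k
  have hk := (Finset.sum_eq_zero_iff_of_nonneg fun j _ => sq_nonneg (y f j)).1 (hf f) k (Finset.mem_univ k)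
  simpa using hk

/-! ## §2 The coercivity of the follower block as a ray second derivative -/

/-- ★★★ **(M2)(a) IN GNOMONIC COORDINATES, EVERY SECTOR.**  Let `C` have commutators and SIGNED σ-relations `≤ s`, let `0 < R ≤ 1`, and suppose the quartic RAY
REMAINDER of `y ↦ F̂_z(C, gno⁺(y))` is `≤ B₄·(Σ|y_f|²)²` on `{Σ|y_f|² ≤ R²}` (hypothesis `h4`).  If `2·(300L⁴s²) ≤ μR²/2` and `2B₄R² ≤ μ/2` with `μ = 1/(2304·L⁶·|Fol L|)`,
then for EVERY `y`:  `μ·Σ_f|y_f|² ≤ (d²/dt²) F̂_z(C, gno⁺(t·y))|₀`. [cite: Luscher1983, §2] -/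
theorem gnoFollower_raySecond_coercive_twisted (z : Fin 3 → Bool) (C : Fin 4 → SU2) {s R B₄ : ℝ} (hs : 0 ≤ s) (hR : 0 < R) (hR1 : R ≤ 1)
    (hCC : ∀ μ ν : Fin 3, frobNorm (((C (Fin.castSucc μ) * C (Fin.castSucc ν) : SU2) : Matrix (Fin 2) (Fin 2) ℂ) -
        ((C (Fin.castSucc ν) * C (Fin.castSucc μ) : SU2) : Matrix (Fin 2) (Fin 2) ℂ)) ≤ s)
    (hσ : ∀ μ : Fin 3, frobNorm (((C (Fin.last 3) * C (Fin.castSucc (Equiv.swap (0 : Fin 3) 1 μ)) : SU2) : Matrix (Fin 2) (Fin 2) ℂ) -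
        ((centreElem (z μ) * C (Fin.castSucc μ) * C (Fin.last 3) : SU2) : Matrix (Fin 2) (Fin 2) ℂ)) ≤ s)
    (h4 : ∀ y : Fol L → Fin 3 → ℝ, ∑ f, normSq3 (y f) ≤ R ^ 2 →
      |chartDeficit L z (fun x => centreElem (Bool.xor (z 0 && decide (x 0 ≠ 0)) (Bool.xor (z 1 && decide (x 1 ≠ 0)) (z 2 && decide (x 2 ≠ 0)))))
            (C, fun f => quatToSU2 (gnoLetter true (y f))) -
          chartDeficit L z (fun x => centreElem (Bool.xor (z 0 && decide (x 0 ≠ 0)) (Bool.xor (z 1 && decide (x 1 ≠ 0)) (z 2 && decide (x 2 ≠ 0)))))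
            (C, fun _ => 1) -
          deriv (fun t : ℝ => chartDeficit L z
            (fun x => centreElem (Bool.xor (z 0 && decide (x 0 ≠ 0)) (Bool.xor (z 1 && decide (x 1 ≠ 0)) (z 2 && decide (x 2 ≠ 0)))))
              (C, fun f => quatToSU2 (gnoLetter true ((t • y) f)))) 0 -
          iteratedDeriv 2 (fun t : ℝ => chartDeficit L z
            (fun x => centreElem (Bool.xor (z 0 && decide (x 0 ≠ 0)) (Bool.xor (z 1 && decide (x 1 ≠ 0)) (z 2 && decide (x 2 ≠ 0)))))
              (C, fun f => quatToSU2 (gnoLetter true ((t • y) f)))) 0 / 2 -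
          iteratedDeriv 3 (fun t : ℝ => chartDeficit L z
            (fun x => centreElem (Bool.xor (z 0 && decide (x 0 ≠ 0)) (Bool.xor (z 1 && decide (x 1 ≠ 0)) (z 2 && decide (x 2 ≠ 0)))))
              (C, fun f => quatToSU2 (gnoLetter true ((t • y) f)))) 0 / 6| ≤ B₄ * (∑ f, normSq3 (y f)) ^ 2)
    (hsmall₁ : 2 * (300 * (L : ℝ) ^ 4 * s ^ 2) ≤ (2304 * (L : ℝ) ^ 6 * (Fintype.card (Fol L) : ℝ))⁻¹ * R ^ 2 / 2)
    (hsmall₂ : 2 * B₄ * R ^ 2 ≤ (2304 * (L : ℝ) ^ 6 * (Fintype.card (Fol L) : ℝ))⁻¹ / 2)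
    (y : Fol L → Fin 3 → ℝ) :
    (2304 * (L : ℝ) ^ 6 * (Fintype.card (Fol L) : ℝ))⁻¹ * ∑ f, normSq3 (y f) ≤
      iteratedDeriv 2 (fun t : ℝ => chartDeficit L z
        (fun x => centreElem (Bool.xor (z 0 && decide (x 0 ≠ 0)) (Bool.xor (z 1 && decide (x 1 ≠ 0)) (z 2 && decide (x 2 ≠ 0)))))
          (C, fun f => quatToSU2 (gnoLetter true ((t • y) f)))) 0 := by
  set χ : Site 3 L → SU2 := fun x => centreElem (Bool.xor (z 0 && decide (x 0 ≠ 0)) (Bool.xor (z 1 && decide (x 1 ≠ 0)) (z 2 && decide (x 2 ≠ 0)))) with hχ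
  -- the three functions of the gauge lemma
  set F : (Fol L → Fin 3 → ℝ) → ℝ := fun y => chartDeficit L z χ (C, fun f => quatToSU2 (gnoLetter true (y f))) with hF
  set N : (Fol L → Fin 3 → ℝ) → ℝ := fun y => ∑ f, normSq3 (y f) with hN
  set Q : (Fol L → Fin 3 → ℝ) → ℝ := fun y => iteratedDeriv 2 (fun t : ℝ => F (t • y)) 0 with hQ
  have hray : ∀ y' : Fol L → Fin 3 → ℝ, (fun t : ℝ => chartDeficit L z χ (C, fun f => quatToSU2 (gnoLetter true ((t • y') f)))) = fun t => F (t • y') :=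
    fun y' => rfl
  have hsmooth : ∀ y' : Fol L → Fin 3 → ℝ, ContDiff ℝ 2 (fun t : ℝ => F (t • y')) := fun y' => contDiff_gnoFollower_ray (n := 2) z χ C y'
  have hF0 : F 0 = chartDeficit L z χ (C, fun _ => 1) := by
    simp only [hF, Pi.zero_apply, gnoPlus_zero]
  -- hypotheses of the gauge lemma
  have hNh : ∀ (t : ℝ) (y' : Fol L → Fin 3 → ℝ), N (t • y') = t ^ 2 * N y' := fun t y' => sum_normSq3_smul t y'
  have hQh : ∀ (t : ℝ) (y' : Fol L → Fin 3 → ℝ), Q (t • y') = t ^ 2 * Q y' := fun t y' => raySecond_homogeneous hsmooth t y'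
  have hN0 : ∀ y', 0 ≤ N y' := fun y' => Finset.sum_nonneg fun f _ => normSq3_nonneg (y' f)
  have hNdef : ∀ y', N y' = 0 → y' = 0 := fun y' h => eq_zero_of_sum_normSq3_eq_zero y' h
  have hgrowth : ∀ y', N y' ≤ R ^ 2 → (2304 * (L : ℝ) ^ 6 * (Fintype.card (Fol L) : ℝ))⁻¹ * N y' ≤ F y' := by
    intro y' hy'
    have hbox : ∀ f, normSq3 (y' f) ≤ 1 := fun f =>
      le_trans (Finset.single_le_sum (fun g _ => normSq3_nonneg (y' g)) (Finset.mem_univ f)) (hy'.trans (by nlinarith))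
    exact gnoFollower_growth_twisted z C y' hbox
  have hT : ∃ σ : (Fol L → Fin 3 → ℝ) → ℝ, (∀ y', σ (-y') = -σ y') ∧
      ∀ y', N y' ≤ R ^ 2 → |F y' - chartDeficit L z χ (C, fun _ => 1) - (1 / 2) * Q y' - σ y'| ≤ B₄ * N y' ^ 2 := by
    refine ⟨fun y' => (F y' - F (-y')) / 2, fun y' => by simp only [neg_neg]; ring, fun y' hy' => ?_⟩
    have hyn : N (-y') = N y' := by rw [show -y' = (-1 : ℝ) • y' by simp, hNh]; norm_num
    have hp := abs_le.1 (h4 y' hy')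
    have hm := abs_le.1 (h4 (-y') (by rw [show (∑ f, normSq3 ((-y') f)) = N (-y') from rfl, hyn]; exact hy'))
    have e1 := deriv_ray_neg F y'
    have e2 := iteratedDeriv_two_ray_neg F y'
    have e3 := iteratedDeriv_three_ray_neg F y'
    simp only [hray] at hp hm
    rw [show (∑ f, normSq3 ((-y') f)) = N (-y') from rfl, hyn] at hm
    rw [← hF0]
    change |F y' - F 0 - 1 / 2 * iteratedDeriv 2 (fun t : ℝ => F (t • y')) 0 - (F y' - F (-y')) / 2| ≤ B₄ * N y' ^ 2
    have hp' : -(B₄ * N y' ^ 2) ≤ F y' - F 0 - deriv (fun t : ℝ => F (t • y')) 0 - iteratedDeriv 2 (fun t : ℝ => F (t • y')) 0 / 2 -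
        iteratedDeriv 3 (fun t : ℝ => F (t • y')) 0 / 6 ∧ F y' - F 0 - deriv (fun t : ℝ => F (t • y')) 0 - iteratedDeriv 2 (fun t : ℝ => F (t • y')) 0 / 2 -
        iteratedDeriv 3 (fun t : ℝ => F (t • y')) 0 / 6 ≤ B₄ * N y' ^ 2 := by rw [hF0]; exact hp
    have hm' : -(B₄ * N y' ^ 2) ≤ F (-y') - F 0 - deriv (fun t : ℝ => F (t • -y')) 0 - iteratedDeriv 2 (fun t : ℝ => F (t • -y')) 0 / 2 -
        iteratedDeriv 3 (fun t : ℝ => F (t • -y')) 0 / 6 ∧ F (-y') - F 0 - deriv (fun t : ℝ => F (t • -y')) 0 - iteratedDeriv 2 (fun t : ℝ => F (t • -y')) 0 / 2 -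
        iteratedDeriv 3 (fun t : ℝ => F (t • -y')) 0 / 6 ≤ B₄ * N y' ^ 2 := by rw [hF0]; exact hm
    rw [e1, e2, e3] at hm'
    rw [abs_le]
    constructor <;> linarith [hp'.1, hp'.2, hm'.1, hm'.2]
  have key := gauge_coercive_of_growth_offset_half (V := Fol L → Fin 3 → ℝ) (N := N) (Q := Q) (f := F)
    (μ := (2304 * (L : ℝ) ^ 6 * (Fintype.card (Fol L) : ℝ))⁻¹) (B₄ := B₄) (R := R) (f₀ := chartDeficit L z χ (C, fun _ => 1))
    hR hNh hQh hN0 hNdef hgrowth hT ?_ hsmall₂ y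
  · exact key
  · have hthin := chartDeficit_twisted_one_le_of_relations (L := L) z C hs hCC hσ
    linarith

/-- ★★★ **(M2)(a) IN GNOMONIC COORDINATES, PRINCIPAL SECTOR** (`χ ≡ 1`, unsigned σ-relations).  Let `C` have commutators and SIGNED σ-relations `≤ s`, let `0 < R ≤ 1`, and suppose the quartic RAY
REMAINDER of `y ↦ F̂_z(C, gno⁺(y))` is `≤ B₄·(Σ|y_f|²)²` on `{Σ|y_f|² ≤ R²}` (hypothesis `h4`).  If `2·(300L⁴s²) ≤ μR²/2` and `2B₄R² ≤ μ/2` with `μ = 1/(2304·L⁶·|Fol L|)`,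
then for EVERY `y`:  `μ·Σ_f|y_f|² ≤ (d²/dt²) F̂_z(C, gno⁺(t·y))|₀`. [cite: Luscher1983, §2] -/
theorem gnoFollower_raySecond_coercive (C : Fin 4 → SU2) {s R B₄ : ℝ} (hs : 0 ≤ s) (hR : 0 < R) (hR1 : R ≤ 1)
    (hCC : ∀ μ ν : Fin 3, frobNorm (((C (Fin.castSucc μ) * C (Fin.castSucc ν) : SU2) : Matrix (Fin 2) (Fin 2) ℂ) -
        ((C (Fin.castSucc ν) * C (Fin.castSucc μ) : SU2) : Matrix (Fin 2) (Fin 2) ℂ)) ≤ s)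
    (hσ : ∀ μ : Fin 3, frobNorm (((C (Fin.last 3) * C (Fin.castSucc (Equiv.swap (0 : Fin 3) 1 μ)) : SU2) : Matrix (Fin 2) (Fin 2) ℂ) -
        ((C (Fin.castSucc μ) * C (Fin.last 3) : SU2) : Matrix (Fin 2) (Fin 2) ℂ)) ≤ s)
    (h4 : ∀ y : Fol L → Fin 3 → ℝ, ∑ f, normSq3 (y f) ≤ R ^ 2 →
      |chartDeficit L (fun _ => false) (fun _ => 1)
            (C, fun f => quatToSU2 (gnoLetter true (y f))) -
          chartDeficit L (fun _ => false) (fun _ => 1)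
            (C, fun _ => 1) -
          deriv (fun t : ℝ => chartDeficit L (fun _ => false) (fun _ => 1)
              (C, fun f => quatToSU2 (gnoLetter true ((t • y) f)))) 0 -
          iteratedDeriv 2 (fun t : ℝ => chartDeficit L (fun _ => false) (fun _ => 1)
              (C, fun f => quatToSU2 (gnoLetter true ((t • y) f)))) 0 / 2 -
          iteratedDeriv 3 (fun t : ℝ => chartDeficit L (fun _ => false) (fun _ => 1)
              (C, fun f => quatToSU2 (gnoLetter true ((t • y) f)))) 0 / 6| ≤ B₄ * (∑ f, normSq3 (y f)) ^ 2)
    (hsmall₁ : 2 * (300 * (L : ℝ) ^ 4 * s ^ 2) ≤ (2304 * (L : ℝ) ^ 6 * (Fintype.card (Fol L) : ℝ))⁻¹ * R ^ 2 / 2)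
    (hsmall₂ : 2 * B₄ * R ^ 2 ≤ (2304 * (L : ℝ) ^ 6 * (Fintype.card (Fol L) : ℝ))⁻¹ / 2)
    (y : Fol L → Fin 3 → ℝ) :
    (2304 * (L : ℝ) ^ 6 * (Fintype.card (Fol L) : ℝ))⁻¹ * ∑ f, normSq3 (y f) ≤
      iteratedDeriv 2 (fun t : ℝ => chartDeficit L (fun _ => false) (fun _ => 1)
          (C, fun f => quatToSU2 (gnoLetter true ((t • y) f)))) 0 := by
  set χ : Site 3 L → SU2 := fun _ => 1 with hχ
  set z : Fin 3 → Bool := fun _ => false with hz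
  -- the three functions of the gauge lemma
  set F : (Fol L → Fin 3 → ℝ) → ℝ := fun y => chartDeficit L z χ (C, fun f => quatToSU2 (gnoLetter true (y f))) with hF
  set N : (Fol L → Fin 3 → ℝ) → ℝ := fun y => ∑ f, normSq3 (y f) with hN
  set Q : (Fol L → Fin 3 → ℝ) → ℝ := fun y => iteratedDeriv 2 (fun t : ℝ => F (t • y)) 0 with hQ
  have hray : ∀ y' : Fol L → Fin 3 → ℝ, (fun t : ℝ => chartDeficit L z χ (C, fun f => quatToSU2 (gnoLetter true ((t • y') f)))) = fun t => F (t • y') :=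
    fun y' => rfl
  have hsmooth : ∀ y' : Fol L → Fin 3 → ℝ, ContDiff ℝ 2 (fun t : ℝ => F (t • y')) := fun y' => contDiff_gnoFollower_ray (n := 2) z χ C y'
  have hF0 : F 0 = chartDeficit L z χ (C, fun _ => 1) := by
    simp only [hF, Pi.zero_apply, gnoPlus_zero]
  -- hypotheses of the gauge lemma
  have hNh : ∀ (t : ℝ) (y' : Fol L → Fin 3 → ℝ), N (t • y') = t ^ 2 * N y' := fun t y' => sum_normSq3_smul t y'
  have hQh : ∀ (t : ℝ) (y' : Fol L → Fin 3 → ℝ), Q (t • y') = t ^ 2 * Q y' := fun t y' => raySecond_homogeneous hsmooth t y'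
  have hN0 : ∀ y', 0 ≤ N y' := fun y' => Finset.sum_nonneg fun f _ => normSq3_nonneg (y' f)
  have hNdef : ∀ y', N y' = 0 → y' = 0 := fun y' h => eq_zero_of_sum_normSq3_eq_zero y' h
  have hgrowth : ∀ y', N y' ≤ R ^ 2 → (2304 * (L : ℝ) ^ 6 * (Fintype.card (Fol L) : ℝ))⁻¹ * N y' ≤ F y' := by
    intro y' hy'
    have hbox : ∀ f, normSq3 (y' f) ≤ 1 := fun f =>
      le_trans (Finset.single_le_sum (fun g _ => normSq3_nonneg (y' g)) (Finset.mem_univ f)) (hy'.trans (by nlinarith))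
    exact gnoFollower_growth C y' hbox
  have hT : ∃ σ : (Fol L → Fin 3 → ℝ) → ℝ, (∀ y', σ (-y') = -σ y') ∧
      ∀ y', N y' ≤ R ^ 2 → |F y' - chartDeficit L z χ (C, fun _ => 1) - (1 / 2) * Q y' - σ y'| ≤ B₄ * N y' ^ 2 := by
    refine ⟨fun y' => (F y' - F (-y')) / 2, fun y' => by simp only [neg_neg]; ring, fun y' hy' => ?_⟩
    have hyn : N (-y') = N y' := by rw [show -y' = (-1 : ℝ) • y' by simp, hNh]; norm_num
    have hp := abs_le.1 (h4 y' hy')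
    have hm := abs_le.1 (h4 (-y') (by rw [show (∑ f, normSq3 ((-y') f)) = N (-y') from rfl, hyn]; exact hy'))
    have e1 := deriv_ray_neg F y'
    have e2 := iteratedDeriv_two_ray_neg F y'
    have e3 := iteratedDeriv_three_ray_neg F y'
    simp only [hray] at hp hm
    rw [show (∑ f, normSq3 ((-y') f)) = N (-y') from rfl, hyn] at hm
    rw [← hF0]
    change |F y' - F 0 - 1 / 2 * iteratedDeriv 2 (fun t : ℝ => F (t • y')) 0 - (F y' - F (-y')) / 2| ≤ B₄ * N y' ^ 2
    have hp' : -(B₄ * N y' ^ 2) ≤ F y' - F 0 - deriv (fun t : ℝ => F (t • y')) 0 - iteratedDeriv 2 (fun t : ℝ => F (t • y')) 0 / 2 -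
        iteratedDeriv 3 (fun t : ℝ => F (t • y')) 0 / 6 ∧ F y' - F 0 - deriv (fun t : ℝ => F (t • y')) 0 - iteratedDeriv 2 (fun t : ℝ => F (t • y')) 0 / 2 -
        iteratedDeriv 3 (fun t : ℝ => F (t • y')) 0 / 6 ≤ B₄ * N y' ^ 2 := by rw [hF0]; exact hp
    have hm' : -(B₄ * N y' ^ 2) ≤ F (-y') - F 0 - deriv (fun t : ℝ => F (t • -y')) 0 - iteratedDeriv 2 (fun t : ℝ => F (t • -y')) 0 / 2 -
        iteratedDeriv 3 (fun t : ℝ => F (t • -y')) 0 / 6 ∧ F (-y') - F 0 - deriv (fun t : ℝ => F (t • -y')) 0 - iteratedDeriv 2 (fun t : ℝ => F (t • -y')) 0 / 2 -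
        iteratedDeriv 3 (fun t : ℝ => F (t • -y')) 0 / 6 ≤ B₄ * N y' ^ 2 := by rw [hF0]; exact hm
    rw [e1, e2, e3] at hm'
    rw [abs_le]
    constructor <;> linarith [hp'.1, hp'.2, hm'.1, hm'.2]
  have key := gauge_coercive_of_growth_offset_half (V := Fol L → Fin 3 → ℝ) (N := N) (Q := Q) (f := F)
    (μ := (2304 * (L : ℝ) ^ 6 * (Fintype.card (Fol L) : ℝ))⁻¹) (B₄ := B₄) (R := R) (f₀ := chartDeficit L z χ (C, fun _ => 1))
    hR hNh hQh hN0 hNdef hgrowth hT ?_ hsmall₂ y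
  · exact key
  · have hthin := chartDeficit_one_le_of_relations (L := L) C hs hCC hσ
    linarith


end Summit.QuantumFields.YangMills.Theorems.SwapVirialDeficit.BlowUpRing

end
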